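import Literature.AlgebraicGeometry.HodgeTheory.AlgebraicCechDeRhamRealization
import Literature.AlgebraicGeometry.HodgeTheory.AlgebraicCechDeRhamBasicOpenCover
import Literature.Geometry.Kaehler.LocalFormsCohomologyComparison
import HarnessLib

/-!
# The realisation of the algebraic Čech–de Rham complex of an affine `X` is compatible with
# Grothendieck's comparison map

[topic AlgebraicGeometry/HodgeTheory]

Let `X` be an AFFINE smooth `ℂ`-scheme with analytic model `A` (`X^an = A.carrier`), an onto-or-not
presentation `φ_{x₀} : ℂ[T₁, …, T_{N₀}] → Γ(X, 𝒪)` with `I₀ = ker φ_{x₀}` (so `Ω^q(X) = RegularForm I₀ q`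
and `H^n_dR(X) = DeRhamCohomology I₀ n`), a family of opens `𝔘 = (U_i)` with affine finite
intersections (`IsAffineCover U`) and charts `C : CoverCharts X 𝔘`. The tree has

* the algebraic Čech–de Rham double complex `Č(𝔘, Ω•_alg)` with its ROW AUGMENTATION by the global
  forms `Ω•(X) → Č⁰(𝔘, Ω•_alg)` and the EDGE MAP `Hⁿ(Ω•(X), d) → Hⁿ(Tot Č(𝔘, Ω•_alg))`
  (`HodgeTheory/AlgebraicCechDeRham`: `CoverCharts.rowAugmentation`, `CoverCharts.edgeMap`);
* the REALISATION `Č(𝔘, Ω•_alg) → Č(𝔘^an, Ω•_smooth)` and `CoverCharts.realizeDeRham :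
  Hⁿ(Tot_ℝ Č(𝔘, Ω•_alg)) → Hⁿ(Ω•(X^an), d)` (`HodgeTheory/AlgebraicCechDeRhamRealization`, node P2 of
  the lane's Route P);
* Grothendieck's comparison map `deRhamComparison A x₀ : H^n_dR(X) → H^n_dR(X^an; ℂ)` on GLOBAL
  classes (`HodgeTheory/RegularFormRealization`, [Grothendieck1966, (5)]) and the identification
  `Hⁿ(Ω•(X^an), d) ≃ complexDeRhamCohomology` (`Geometry/Kaehler/LocalFormsCohomologyComparison`).

This file proves that these fit into ONE commutative square — the degeneration statement
"`ℍ*(X, Ω•_alg) = H*(Γ(X, Ω•))` for affine `X`, compatibly with the map to `X^an`"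
[Grothendieck1966, p. 96 (4)–(6); CattaniElZeinGriffithsLe2014, Ch. 2 §2.9.2 (p. 109) (2.9.1)–(2.9.2):
"a similar computation … compatibly with the restriction maps"]:

* `CoverCharts.rowAugmentationℝ`, `CoverCharts.edgeMapℝ` — the row augmentation and edge map with
  scalars restricted to `ℝ` (the smooth side is a complex of real vector spaces), bijective under the
  same exactness hypotheses (`bijective_edgeMapℝ`);
* `AnalyticModel.globalRealize` — the holomorphic image `Ω^q(X) → Ω^q(X^an)` as a map into the forms
  on `univ`, and **`CoverCharts.realizeAugHom`**: together with the realisation of Čech cochains it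
  is a MORPHISM OF ROW AUGMENTATIONS (`ADoubleComplex.RowAugmentation.Hom`) — it commutes with `d`
  (`regularFormRealize_d`) and with the augmentations (restricting the global holomorphic image to
  the open piece over `U_i` is the local realisation of the algebraic restriction,
  `AnalyticModel.restr_regularFormRealize`);
* **`CoverCharts.realizeDeRham_edgeMapℝ`** — `realizeDeRham ∘ edgeMapℝ = Hⁿ(globalRealize)`
  (naturality of edge maps, `RowAugmentation.Hom.totMap_cohMap`), and
  **`CoverCharts.localCohomologyEquivComplexDeRham_realizeDeRham_edgeMapℝ`** — on the class of a
  closed global form `z`, `realizeDeRham (edgeMapℝ [z])` read in `complexDeRhamCohomology` IS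
  `deRhamComparison A x₀ [z]`;
* consequences when the augmented rows are exact (e.g. for a finite basic-open cover of an affine
  `X`, `HodgeTheory/AlgebraicCechDeRhamBasicOpenCover`): the realised algebraic Čech–de Rham classes
  are EXACTLY the image of Grothendieck's comparison map (`range_realizeDeRham_eq`), so
  `realizeDeRham` is onto iff `deRhamComparison` is (`surjective_realizeDeRham_iff`) — the form in
  which Route P feeds the surjectivity half of [Grothendieck1966, Thm. 1′] (the tree's named fact
  `grothendieck_comparison_realize_surjective`, via `RegularFormRealization`); in particular,
  UNCONDITIONALLY for a finite basic-open cover `(D(g_i))` of the affine `X` with onto presentation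
  (`isAffineCover_basicCover`, `iSup_basicCover_eq_top`,
  **`surjective_realizeDeRham_iff_of_basicCover`**, by `HodgeTheory/AlgebraicCechDeRhamBasicOpenCover`).

Everything is proved; definitions with bodies; no named facts (net debt 0).

## References

* [Grothendieck1966] A. Grothendieck, *On the de Rham cohomology of algebraic varieties*, Publ.
  Math. IHÉS 29 (1966), p. 96 (4)–(6), Thm. 1′.
* [CattaniElZeinGriffithsLe2014] E. Cattani, F. El Zein, P. Griffiths, Lê D. T. (eds.), *Hodge
  Theory*, Princeton Math. Notes 49 (2014), Ch. 2 (F. El Zein, L. Tu) §2.9.2, p. 109, (2.9.1)–(2.9.2).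
* [BottTu1982Forms] R. Bott, L. W. Tu, *Differential Forms in Algebraic Topology*, §8, Prop. 8.8.
* [Weibel1994] C. Weibel, *An Introduction to Homological Algebra*, 1.2.4, Thm. 2.7.2, Lemma 2.7.3.
* [Hartshorne1977] R. Hartshorne, *Algebraic Geometry*, II Prop. 2.2 (b).
-/

noncomputable section

universe u

open scoped Manifold ContDiff Topology
open Set CategoryTheory AlgebraicGeometry MvPolynomial
open Literature.Geometry.Kaehler Literature.Algebra.Homology
open Literature.AlgebraicGeometry.Motives Literature.AlgebraicGeometry.Motives.AffineDeRham

namespace Literature.AlgebraicGeometry.HodgeTheory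

section HodgeTheory

variable {X : Motives.SchemeOver ℂ} {ι : Type u} {U : ι → X.left.Opens}

/-! ### The row augmentation and the edge map over `ℝ` -/

namespace CoverCharts

variable (C : CoverCharts X U) {N₀ : ℕ} (x₀ : Fin N₀ → Γ(X.left, ⊤))

/-- **The row augmentation of `Č(𝔘, Ω•_alg)` by the global forms, scalars restricted to `ℝ`**
(`C.rowAugmentation x₀` for the `ℝ`-double complex `C.cechDeRhamℝ`). [cite: Weibel1994, 1.2.4]
[cite: Grothendieck1966, p. 96 (6)] -/
def rowAugmentationℝ :
    C.cechDeRhamℝ.RowAugmentation (fun q ↦ RegularForm (RingHom.ker (coordPresentation X x₀)) q) where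
  dA q := (RegularForm.d (RingHom.ker (coordPresentation X x₀)) (p := q)).restrictScalars ℝ
  ε q := (C.restrict x₀ q).restrictScalars ℝ
  ε_dA q r := (C.rowAugmentation x₀).ε_dA q r
  δ_ε q r := (C.rowAugmentation x₀).δ_ε q r

/-- The `ℝ`-augmentation differential is `d`. [cite: Grothendieck1966, p. 96 (4)] -/
@[simp]
theorem rowAugmentationℝ_dA_apply (q : ℕ) (r : RegularForm (RingHom.ker (coordPresentation X x₀)) q) :
    (C.rowAugmentationℝ x₀).dA q r = RegularForm.d _ r :=
  rfl

/-- The `ℝ`-augmentation is the restriction `Ω^q(X) → Č⁰(𝔘, Ω^q_alg)`. [cite: Grothendieck1966, p. 96 (6)] -/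
@[simp]
theorem rowAugmentationℝ_ε_apply (q : ℕ) (r : RegularForm (RingHom.ker (coordPresentation X x₀)) q) :
    (C.rowAugmentationℝ x₀).ε q r = C.restrict x₀ q r :=
  rfl

/-- **The edge map `Hⁿ(Ω•(X), d) → Hⁿ(Tot_ℝ Č(𝔘, Ω•_alg))` over `ℝ`** (the source of
`CoverCharts.realizeDeRham`). [cite: Grothendieck1966, p. 96 (6)] -/
abbrev edgeMapℝ (n : ℕ) :
    NatCochain.Cohomology (C.rowAugmentationℝ x₀).dA n →ₗ[ℝ] NatCochain.Cohomology C.cechDeRhamℝ.totD n :=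
  (C.rowAugmentationℝ x₀).totMap n

/-- Row exactness does not see the scalars. [cite: Weibel1994, Lemma 2.7.3] -/
theorem rowExact_cechDeRhamℝ (hK : C.cechDeRham.RowExact) : C.cechDeRhamℝ.RowExact :=
  ⟨hK.exact⟩

/-- Exactness of the augmented rows at the column `0` does not see the scalars.
[cite: Weibel1994, Lemma 2.7.3] -/
theorem exact_rowAugmentationℝ (hE : (C.rowAugmentation x₀).Exact) : (C.rowAugmentationℝ x₀).Exact :=
  ⟨hE.injective, hE.exact⟩

/-- **The `ℝ`-edge map is bijective when the augmented rows are exact** (e.g. for a finite basic-open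
cover of an affine `X`). [cite: Weibel1994, Thm. 2.7.2] [cite: Grothendieck1966, p. 96 (4)] -/
theorem bijective_edgeMapℝ (hK : C.cechDeRham.RowExact) (hE : (C.rowAugmentation x₀).Exact) (n : ℕ) :
    Function.Bijective (C.edgeMapℝ x₀ n) :=
  (C.rowAugmentationℝ x₀).bijective_totMap (C.rowExact_cechDeRhamℝ hK)
    (C.exact_rowAugmentationℝ x₀ hE) n

end CoverCharts

/-! ### The global holomorphic image as a map into the forms on `univ` -/

variable {E : Type} [NormedAddCommGroup E] [NormedSpace ℂ E] [FiniteDimensional ℂ E] {m : ℕ}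

namespace AnalyticModel

variable [IsAffine X.left] (A : AnalyticModel E m X) {N₀ : ℕ} (x₀ : Fin N₀ → Γ(X.left, ⊤))

/-- **The holomorphic image `Ω^q(X) → Ω^q(X^an)` of global regular forms** (`regularFormRealize` for
`I₀ = ker φ_{x₀}`), valued in the smooth forms on `univ ⊆ X^an` and `ℝ`-linear — the augmentation
component of the realisation morphism. [cite: Grothendieck1966, (5)] -/
def globalRealize (q : ℕ) :
    RegularForm (RingHom.ker (coordPresentation X x₀)) q →ₗ[ℝ]
      ↥(smoothFormsOn 𝓘(ℝ, E) ℂ (univ : Set A.carrier) q) :=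
  ((regularFormRealize A x₀ le_rfl q).restrictScalars ℝ).codRestrict _ fun r ↦ by
    rw [smoothFormsOn_univ, mem_smoothForms_iff]
    exact isSmoothForm_regularFormRealize A x₀ le_rfl q r

/-- Underlying form of `globalRealize`. [cite: Grothendieck1966, (5)] -/
@[simp]
theorem coe_globalRealize (q : ℕ) (r : RegularForm (RingHom.ker (coordPresentation X x₀)) q) :
    (A.globalRealize x₀ q r : MForm 𝓘(ℝ, E) A.carrier ℂ q) = regularFormRealize A x₀ le_rfl q r :=
  rfl

end AnalyticModel

/-! ### The realisation is a morphism of row augmentations -/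

namespace CoverCharts

variable [IsAffine X.left] [IsAffineCover U] [SmoothOfRelativeDimension m X.hom]
  (C : CoverCharts X U) {N₀ : ℕ} (x₀ : Fin N₀ → Γ(X.left, ⊤)) (A : AnalyticModel E m X)

/-- **The realisation is a morphism of augmented double complexes**
`(Ω•(X) → Č(𝔘, Ω•_alg)) ⟶ (Ω•(X^an) → Č(𝔘^an, Ω•_smooth))`: the global holomorphic image commutes
with `d` (`regularFormRealize_d`), and restricting it to the open piece `ψ⁻¹U_i(ℂ)` is the local
realisation of the algebraic restriction to `U_i` (`AnalyticModel.restr_regularFormRealize`).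
[cite: Grothendieck1966, p. 96 (6)] [cite: CattaniElZeinGriffithsLe2014, Ch. 2 §2.9.2 (p. 109)] -/
def realizeAugHom :
    (C.rowAugmentationℝ x₀).Hom (cechDeRhamRow 𝓘(ℝ, E) ℂ (A.isOpen_coverSet U)) (C.realizeHom A) where
  g q := A.globalRealize x₀ q
  g_dA q r := by
    apply Subtype.ext
    change regularFormRealize A x₀ le_rfl (q + 1) (RegularForm.d _ r) =
      (mextDeriv (regularFormRealize A x₀ le_rfl q r)).restr univ
    rw [MForm.restr_univ, regularFormRealize_d]
  ε_g q r := by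
    funext J
    apply Subtype.ext
    change (regularFormRealize A x₀ le_rfl q r).restr (cechSet (A.coverSet U) J) =
      A.realizeOn (C.coord J) le_rfl q (C.res₀ x₀ J q r)
    rw [A.cechSet_coverSet U J]
    exact A.restr_regularFormRealize (C.lift₀_spec x₀ J) le_rfl le_rfl (C.map_lift₀_le x₀ J) q r

/-- The augmentation component of `realizeAugHom` is `globalRealize`. [cite: Grothendieck1966, (5)] -/
@[simp]
theorem realizeAugHom_g (q : ℕ) : (C.realizeAugHom x₀ A).g q = A.globalRealize x₀ q :=
  rfl

/-! ### The square on cohomology -/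

variable [Fintype ι] (hU : ⨆ i, U i = ⊤)

/-- **Naturality of the edge maps**: realising the edge-map image of a global class is the class of
its global holomorphic image, `realizeDeRham ∘ edgeMapℝ = Hⁿ(globalRealize)`
(`RowAugmentation.Hom.totMap_cohMap` and the bijectivity of the smooth edge map, Bott–Tu Prop. 8.8).
[cite: BottTu1982Forms, Prop. 8.8] [cite: Grothendieck1966, p. 96 (6)] -/
theorem realizeDeRham_edgeMapℝ (n : ℕ) (c : NatCochain.Cohomology (C.rowAugmentationℝ x₀).dA n) :
    C.realizeDeRham A hU n (C.edgeMapℝ x₀ n c) = (C.realizeAugHom x₀ A).cohMap n c := by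
  apply (A.bijective_cechDeRhamRow_totMap U hU n).1
  rw [totMap_realizeDeRham]
  exact ((C.realizeAugHom x₀ A).totMap_cohMap n c).symm

/-- **`realizeDeRham ∘ edgeMap = deRhamComparison` on global classes**: for a closed global regular
form `z`, the realisation of the algebraic Čech–de Rham class `edgeMapℝ [z]`, read in
`complexDeRhamCohomology` through `localCohomologyEquivComplexDeRham`, is Grothendieck's comparison
class `deRhamComparison A x₀ [z] = [z^an]`. [cite: Grothendieck1966, p. 96 (4)–(6)]
[cite: CattaniElZeinGriffithsLe2014, Ch. 2 §2.9.2 (p. 109)] -/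
theorem localCohomologyEquivComplexDeRham_realizeDeRham_edgeMapℝ (n : ℕ)
    (z : NatCochain.cocycles (C.rowAugmentationℝ x₀).dA n) :
    localCohomologyEquivComplexDeRham n
        (C.realizeDeRham A hU n (C.edgeMapℝ x₀ n (NatCochain.Cohomology.mk _ n z))) =
      deRhamComparison A x₀ le_rfl n
        (DeRhamCohomology.mk (RingHom.ker (coordPresentation X x₀)) ⟨z, z.2⟩) := by
  rw [realizeDeRham_edgeMapℝ]
  exact localCohomologyEquivComplexDeRham_mk n
    (NatCochain.Cohomology.mapCocycles (C.realizeAugHom x₀ A).g (C.realizeAugHom x₀ A).g_dA n z)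
    (regularFormRealize_mem_cclosedSmoothForms A x₀ le_rfl n z.2)

/-- **When the augmented rows are exact, the realised algebraic Čech–de Rham classes are exactly the
image of Grothendieck's comparison map** (in `complexDeRhamCohomology E X^an n`).
[cite: Grothendieck1966, p. 96 (4)–(6)] [cite: CattaniElZeinGriffithsLe2014, Ch. 2 §2.9.2 (p. 109)] -/
theorem range_realizeDeRham_eq (hK : C.cechDeRham.RowExact) (hE : (C.rowAugmentation x₀).Exact)
    (n : ℕ) :
    Set.range (fun c ↦ localCohomologyEquivComplexDeRham n (C.realizeDeRham A hU n c)) =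
      Set.range (deRhamComparison A x₀ le_rfl n) := by
  ext y
  constructor
  · rintro ⟨c, rfl⟩
    obtain ⟨c', rfl⟩ := (C.bijective_edgeMapℝ x₀ hK hE n).2 c
    obtain ⟨z, rfl⟩ := NatCochain.Cohomology.mk_surjective _ n c'
    exact ⟨_, (C.localCohomologyEquivComplexDeRham_realizeDeRham_edgeMapℝ x₀ A hU n z).symm⟩
  · rintro ⟨r, rfl⟩
    obtain ⟨z, rfl⟩ := DeRhamCohomology.mk_surjective _ r
    exact ⟨C.edgeMapℝ x₀ n (NatCochain.Cohomology.mk _ n ⟨z, z.2⟩),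
      C.localCohomologyEquivComplexDeRham_realizeDeRham_edgeMapℝ x₀ A hU n ⟨z, z.2⟩⟩

/-- **Route P's reduction for an affine `X`**: when the augmented rows of `Č(𝔘, Ω•_alg)` are exact,
the realisation `Hⁿ(Tot Č(𝔘, Ω•_alg)) → Hⁿ_dR(X^an; ℂ)` is onto iff Grothendieck's comparison map
`Hⁿ_dR(X) → Hⁿ_dR(X^an; ℂ)` is onto (the surjectivity half of [Grothendieck1966, Thm. 1′] for `X`).
[cite: Grothendieck1966, Thm. 1'] [cite: CattaniElZeinGriffithsLe2014, Ch. 2 §2.9.2 (p. 109)] -/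
theorem surjective_realizeDeRham_iff (hK : C.cechDeRham.RowExact) (hE : (C.rowAugmentation x₀).Exact)
    (n : ℕ) :
    Function.Surjective (C.realizeDeRham A hU n) ↔
      Function.Surjective (deRhamComparison A x₀ le_rfl n) := by
  have h := C.range_realizeDeRham_eq x₀ A hU hK hE n
  have he := (localCohomologyEquivComplexDeRham (E := E) (M := A.carrier) n).bijective
  constructor
  · intro hs
    rw [← Set.range_eq_univ, ← h, Set.range_eq_univ]
    exact he.2.comp hs
  · intro hs
    have h2 : Function.Surjective
        (fun c ↦ localCohomologyEquivComplexDeRham n (C.realizeDeRham A hU n c)) := by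
      rw [← Set.range_eq_univ, h, Set.range_eq_univ]
      exact hs
    exact (Function.Surjective.of_comp_iff' he (C.realizeDeRham A hU n)).1 h2

end CoverCharts

/-! ### Affine `X` with a finite basic-open cover: the unconditional form -/

section BasicCover

variable [IsAffine X.left] {N₀ : ℕ} (x₀ : Fin N₀ → Γ(X.left, ⊤)) (G : ι → MvPolynomial (Fin N₀) ℂ)

/-- The finite intersections `U_J = D(g_J)` of a basic-open cover of an affine scheme are affine.
[cite: Hartshorne1977, II Prop. 2.2 (b)] -/
instance isAffineCover_basicCover : IsAffineCover (basicCover x₀ G) :=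
  ⟨fun J ↦ by
    rw [cechOpen_basicCover]
    exact (isAffineOpen_top X.left).basicOpen _⟩

variable {x₀ G} in
/-- If the `g_i = φ_{x₀}(G_i)` generate the unit ideal of `Γ(X, 𝒪)` then the `D(g_i)` cover the affine
`X`. [cite: Hartshorne1977, II Prop. 2.2 (b)] -/
theorem iSup_basicCover_eq_top
    (hcov : Ideal.span (Set.range fun i ↦ coordPresentation X x₀ (G i)) = ⊤) :
    ⨆ i, basicCover x₀ G i = ⊤ := by
  have h := (isAffineOpen_top X.left).iSup_basicOpen_eq_self_iff
    (s := Set.range fun i ↦ coordPresentation X x₀ (G i))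
  rw [iSup_range' (fun f ↦ X.left.basicOpen f) (fun i ↦ coordPresentation X x₀ (G i))] at h
  exact h.2 hcov

variable [SmoothOfRelativeDimension m X.hom] [Fintype ι]

/-- **Route P for an affine `X`, unconditionally**: for a finite basic-open cover `𝔘 = (D(g_i))` of a
smooth affine `X` with onto presentation `φ_{x₀}` and `(g_i) = Γ(X, 𝒪)`, any charts `C` and any
analytic model `A`, the realised algebraic Čech–de Rham classes of `𝔘` are exactly the image of
Grothendieck's comparison map, so `realizeDeRham : Hⁿ(Tot Č(𝔘, Ω•_alg)) → Hⁿ_dR(X^an; ℂ)` is onto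
iff `deRhamComparison : Hⁿ_dR(X) → Hⁿ_dR(X^an; ℂ)` is. [cite: Grothendieck1966, p. 96 (4)–(6)]
[cite: CattaniElZeinGriffithsLe2014, Ch. 2 §2.9.2 (p. 109)] -/
theorem surjective_realizeDeRham_iff_of_basicCover (C : CoverCharts X (basicCover x₀ G))
    (A : AnalyticModel E m X) (hx₀ : Function.Surjective (coordPresentation X x₀))
    (hcov : Ideal.span (Set.range fun i ↦ coordPresentation X x₀ (G i)) = ⊤) (n : ℕ) :
    Function.Surjective (C.realizeDeRham A (iSup_basicCover_eq_top hcov) n) ↔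
      Function.Surjective (deRhamComparison A x₀ le_rfl n) :=
  C.surjective_realizeDeRham_iff x₀ A (iSup_basicCover_eq_top hcov) (C.rowExact_of_basicCover hx₀ hcov)
    (C.exact_rowAugmentation_of_basicCover hx₀ hcov) n

/-- The image statement behind `surjective_realizeDeRham_iff_of_basicCover`.
[cite: Grothendieck1966, p. 96 (4)–(6)] -/
theorem range_realizeDeRham_eq_of_basicCover (C : CoverCharts X (basicCover x₀ G))
    (A : AnalyticModel E m X) (hx₀ : Function.Surjective (coordPresentation X x₀))
    (hcov : Ideal.span (Set.range fun i ↦ coordPresentation X x₀ (G i)) = ⊤) (n : ℕ) :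
    Set.range (fun c ↦ localCohomologyEquivComplexDeRham n
        (C.realizeDeRham A (iSup_basicCover_eq_top hcov) n c)) =
      Set.range (deRhamComparison A x₀ le_rfl n) :=
  C.range_realizeDeRham_eq x₀ A (iSup_basicCover_eq_top hcov) (C.rowExact_of_basicCover hx₀ hcov)
    (C.exact_rowAugmentation_of_basicCover hx₀ hcov) n

end BasicCover

end HodgeTheory

end Literature.AlgebraicGeometry.HodgeTheory

end
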